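import Literature.AlgebraicGeometry.Resolution.PowerSeriesRegularLocal
import Literature.AlgebraicGeometry.Resolution.PowerSeriesPBasis
import Literature.RingTheory.KrullDimension.AffineDimension
import HarnessLib

/-!
# `DescentPerfectToAll` — negative lemma, part 1: constants of the twisted derivation
`D = ∂₀ + X₀·(X₁∂₁ + X₂∂₂)` of `k⟦X₀, X₁, X₂⟧` in characteristic `p`

Support (negative) lemma for crux `stmt-ResolutionOfSingularities-0549`
(`Summit.ResolutionOfSingularities.ResolutionOfSingularities.Theses.WeightedInvariant.DescentPerfectToAll`,
shared verbatim by routes Descent / WeightedInvariant / UniformComplexity), filed by the standing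
disprover (cdisprove gen 3); consumed by `InvariantsRegularOfNonsingularDerivationFalse.lean`, which
refutes the first lemma `InvariantsRegularOfNonsingularDerivation` of crux-idea card
`constant-foliation-descent` (`Cruxes/DescentPerfectToAll/Disproof.lean` §8). This file declares NO
definition: the derivation is a variable `D` with its defining equation `hD`, exponent vectors are
written `equivFunOnFinite.symm ![j, b, c]`. For any field `k` of characteristic `p`:

* `D = ∂₀ + X₀·(X₁∂₁ + X₂∂₂)` (`MvPowerSeries.pderiv` / `MvPowerSeries.eulerDerivation` of the
  tree), its coefficient formula `coeff_D` and the recursion `rel` :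
  `(j+1)·φ_{(j+1,b,c)} + [j ≥ 1](b+c)·φ_{(j-1,b,c)} = 0` for a constant `φ` (`D φ = 0`);
  `D X₀ = 1` (`D_X_zero`: a unit value, "nonsingular");
* constants: closed under products (`D_mul_eq_zero`), contain `k` (`D_C`) and
  `k⟦X₀^p, X₁^p, X₂^p⟧` (`D_eq_zero_of_mem_pSeriesSubring`), whence **`k⟦X⟧` is module-finite over
  any subring containing the constants** (`moduleFinite_of_constants`, via `mem_span_pMonomials` of
  `PowerSeriesPBasis.lean`);
* **low-degree vanishing**: a constant has no monomial `X₀ⁱ`, `p ∤ i` (`coeff_X0pow_eq_zero`) and no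
  monomial `X₁ᵇX₂ᶜ` with `p ∤ b + c` (`coeff_fs_zero_eq_zero`, by the DESCENDING even chain
  `coeff_even_eq_zero` from `φ_{(2p-2,b,c)} = 0`, the recursion at `j = 2p − 1` where the factor `2p`
  dies).

(So `ker D = k⟦X₀^p⟧ ⊗̂ k⟦X₁,X₂⟧^{X₁∂₁+X₂∂₂}`, the `(1/p)(1,1)` cyclic quotient singularity times a
line; only the two vanishing statements are needed downstream. `D` is not p-closed:
`D^p = X₀^p (X₁∂₁ + X₂∂₂) ∉ R·D`.)

## Sources
* H. Matsumura, *Commutative Ring Theory*, CUP 1986, §30 p. 243 (p-monomial expansion of `k⟦X⟧`).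
  [Matsumura1987]
* A. G. Aramova, L. L. Avramov, Singularities of quotients by vector fields in characteristic `p`,
  Math. Ann. 273 (1986) 629–645 (context: the p-closed case is a theorem). [folklore computation here]
-/

noncomputable section

open MvPowerSeries IsLocalRing Finsupp
open Literature.AlgebraicGeometry.Resolution

set_option linter.dupNamespace false

namespace Summit.ResolutionOfSingularities.ResolutionOfSingularities.Theorems.DescentPerfectToAll.Negative

variable (k : Type) [Field k]

/-! ### Exponent vectors `(j, b, c)`, written `equivFunOnFinite.symm ![j, b, c] : Fin 3 →₀ ℕ` -/

/-- First exponent. [folklore] -/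
@[simp] theorem fs_zero (j b c : ℕ) : equivFunOnFinite.symm ![j, b, c] 0 = j := rfl

/-- Second exponent. [folklore] -/
@[simp] theorem fs_one (j b c : ℕ) : equivFunOnFinite.symm ![j, b, c] 1 = b := rfl

/-- Third exponent. [folklore] -/
@[simp] theorem fs_two (j b c : ℕ) : equivFunOnFinite.symm ![j, b, c] 2 = c := rfl

/-- Every exponent vector is of this form. [folklore] -/
theorem fs_eq (m : Fin 3 →₀ ℕ) : m = equivFunOnFinite.symm ![m 0, m 1, m 2] := by
  ext i; fin_cases i <;> rfl

/-- Shifting the `X₀`-exponent up. [folklore] -/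
theorem fs_add_single (j b c : ℕ) :
    equivFunOnFinite.symm ![j, b, c] + single 0 1 = equivFunOnFinite.symm ![j + 1, b, c] := by
  ext i; fin_cases i <;> simp

/-- `X₀ ∣ X^{(j,b,c)}` iff `1 ≤ j`. [folklore] -/
theorem single_le_fs (j b c : ℕ) :
    single (0 : Fin 3) 1 ≤ equivFunOnFinite.symm ![j, b, c] ↔ 1 ≤ j := by
  rw [Finsupp.single_le_iff]; rfl

/-- Shifting the `X₀`-exponent down. [folklore] -/
theorem fs_sub_single (j b c : ℕ) :
    equivFunOnFinite.symm ![j, b, c] - single 0 1 = equivFunOnFinite.symm ![j - 1, b, c] := by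
  ext i; fin_cases i <;> simp

/-! ### Generic facts -/

/-- Transfer of span membership from a subring of scalars to a larger one. [folklore] -/
theorem mem_span_of_le {A : Type*} [CommRing A] {T T' : Subring A} (h : T ≤ T') (F : Set A)
    {x : A} (hx : x ∈ Submodule.span T F) : x ∈ Submodule.span T' F := by
  induction hx using Submodule.span_induction with
  | mem y hy => exact Submodule.subset_span hy
  | zero => exact Submodule.zero_mem _
  | add y z _ _ hy hz => exact Submodule.add_mem _ hy hz
  | smul t y _ hy =>
    have : (t • y : A) = (⟨(t : A), h t.2⟩ : T') • y := rfl
    rw [this]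
    exact Submodule.smul_mem _ _ hy

/-- `k` is a finite module over its top subfield (spanned by `1`). [folklore] -/
theorem moduleFinite_top_subfield : Module.Finite (⊤ : Subfield k) k := by
  rw [Module.finite_def, Submodule.fg_def]
  refine ⟨{1}, Set.finite_singleton 1, ?_⟩
  rw [eq_top_iff]
  rintro x -
  have : x = (⟨x, trivial⟩ : (⊤ : Subfield k)) • (1 : k) := by
    rw [Subfield.smul_def, smul_eq_mul, mul_one]
  rw [this]
  exact Submodule.smul_mem _ _ (Submodule.subset_span rfl)

/-! ### The twisted derivation

Throughout, `D` is the twisted derivation `∂₀ + X₀·(X₁∂₁ + X₂∂₂)` of `k⟦X₀, X₁, X₂⟧`, carried as a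
variable together with its defining equation `hD` (so that this support file declares no
definition); `MvPowerSeries.pderiv` and `MvPowerSeries.eulerDerivation` are the tree's. -/

variable (D : Derivation k (MvPowerSeries (Fin 3) k) (MvPowerSeries (Fin 3) k))

/-- Products of constants of a derivation are constants. [folklore] -/
theorem D_mul_eq_zero {a b : MvPowerSeries (Fin 3) k} (ha : D a = 0) (hb : D b = 0) :
    D (a * b) = 0 := by
  rw [Derivation.leibniz, ha, hb, smul_zero, smul_zero, add_zero]

/-- Scalars are constants of a `k`-derivation. [folklore] -/
theorem D_C (c : k) : D (C c : MvPowerSeries (Fin 3) k) = 0 := by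
  rw [MvPowerSeries.c_eq_algebraMap, Derivation.map_algebraMap]

variable (hD : D = MvPowerSeries.pderiv 0 +
  (X 0 : MvPowerSeries (Fin 3) k) • (MvPowerSeries.eulerDerivation 1 + MvPowerSeries.eulerDerivation 2))
include hD

/-- `D φ = ∂₀φ + X₀·(X₁∂₁φ + X₂∂₂φ)`. [folklore] -/
theorem D_apply (φ : MvPowerSeries (Fin 3) k) :
    D φ = MvPowerSeries.pderiv 0 φ +
      X 0 * (MvPowerSeries.eulerDerivation 1 φ + MvPowerSeries.eulerDerivation 2 φ) := by
  subst hD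
  simp [mul_add]

/-- Coefficient formula for `D`: the coefficient of `X^m` in `Dφ` is
`(m₀+1)·φ_{m+e₀} + [m₀ ≥ 1](m₁+m₂)·φ_{m-e₀}`. [folklore] -/
theorem coeff_D (φ : MvPowerSeries (Fin 3) k) (m : Fin 3 →₀ ℕ) :
    coeff m (D φ) = ((m 0 : k) + 1) * coeff (m + single 0 1) φ +
      (if single 0 1 ≤ m then ((m 1 : k) + (m 2 : k)) * coeff (m - single 0 1) φ else 0) := by
  classical
  rw [D_apply k D hD, map_add, MvPowerSeries.coeff_pderiv, X_def, coeff_monomial_mul]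
  congr 1
  split_ifs with h
  · rw [one_mul, map_add, MvPowerSeries.coeff_eulerDerivation, MvPowerSeries.coeff_eulerDerivation,
      ← add_mul]
    congr 2
    · rw [Finsupp.tsub_apply, single_eq_of_ne (by decide), Nat.sub_zero]
    · rw [Finsupp.tsub_apply, single_eq_of_ne (by decide), Nat.sub_zero]
  · rfl

/-- The coefficient recursion for a constant `φ` (`D φ = 0`):
`(j+1)·φ_{(j+1,b,c)} + [j ≥ 1](b+c)·φ_{(j-1,b,c)} = 0`. [folklore] -/
theorem rel {φ : MvPowerSeries (Fin 3) k} (hφ : D φ = 0) (j b c : ℕ) :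
    ((j : k) + 1) * coeff (equivFunOnFinite.symm ![j + 1, b, c]) φ +
      (if 1 ≤ j then ((b : k) + (c : k)) * coeff (equivFunOnFinite.symm ![j - 1, b, c]) φ
        else 0) = 0 := by
  have := congrArg (coeff (equivFunOnFinite.symm ![j, b, c])) hφ
  rw [map_zero, coeff_D k D hD, fs_add_single, fs_sub_single] at this
  simpa [single_le_fs] using this

/-- `D X₀ = 1`: the derivation is nonsingular (has a unit value). [folklore] -/
theorem D_X_zero : D (X 0) = 1 := by
  classical
  rw [D_apply k D hD, MvPowerSeries.pderiv_X, if_pos rfl]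
  have h1 : MvPowerSeries.eulerDerivation 1 (X 0 : MvPowerSeries (Fin 3) k) = 0 := by
    ext e; rw [MvPowerSeries.coeff_eulerDerivation, coeff_X, map_zero]
    split_ifs with he
    · subst he; simp
    · rw [mul_zero]
  have h2 : MvPowerSeries.eulerDerivation 2 (X 0 : MvPowerSeries (Fin 3) k) = 0 := by
    ext e; rw [MvPowerSeries.coeff_eulerDerivation, coeff_X, map_zero]
    split_ifs with he
    · subst he; simp
    · rw [mul_zero]
  rw [h1, h2, add_zero, mul_zero, add_zero]

/-- **`k⟦X₀^p, X₁^p, X₂^p⟧ ⊆ ker D`** (coefficientwise: both terms of `coeff_D` carry a factor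
divisible by `p` or a coefficient off `pℕ³`). [folklore] -/
theorem D_eq_zero_of_mem_pSeriesSubring (p : ℕ) [Fact p.Prime] [CharP k p]
    {φ : MvPowerSeries (Fin 3) k} (hφ : φ ∈ pSeriesSubring (n := 3) p (⊤ : Subfield k)) :
    D φ = 0 := by
  rw [mem_pSeriesSubring_iff] at hφ
  ext m
  rw [coeff_D k D hD, (coeff m).map_zero]
  have h1 : ((m 0 : k) + 1) * coeff (m + single 0 1) φ = 0 := by
    by_cases h : p ∣ m 0 + 1
    · have : ((m 0 : k) + 1) = ((m 0 + 1 : ℕ) : k) := by push_cast; ring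
      rw [this, (CharP.cast_eq_zero_iff k p _).mpr h, zero_mul]
    · rw [(hφ _).2 ⟨0, by simpa using h⟩, mul_zero]
  have h2 : (if single 0 1 ≤ m then
      ((m 1 : k) + (m 2 : k)) * coeff (m - single 0 1) φ else 0) = 0 := by
    split_ifs with hle
    · by_cases h1' : p ∣ m 1
      · by_cases h2' : p ∣ m 2
        · rw [(CharP.cast_eq_zero_iff k p _).mpr h1', (CharP.cast_eq_zero_iff k p _).mpr h2',
            add_zero, zero_mul]
        · rw [(hφ _).2 ⟨2, ?_⟩, mul_zero]
          rwa [Finsupp.tsub_apply, single_eq_of_ne (by decide), Nat.sub_zero]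
      · rw [(hφ _).2 ⟨1, ?_⟩, mul_zero]
        rwa [Finsupp.tsub_apply, single_eq_of_ne (by decide), Nat.sub_zero]
    · rfl
  rw [h1, h2, add_zero]

/-- **`k⟦X₀,X₁,X₂⟧` is module-finite over any subring containing the constants of `D`** (it is
already generated by the `p³` p-monomials over `k⟦X^p⟧ ⊆ ker D`, Matsumura §30).
[cite: Matsumura1987, §30 p. 243, proof of Thm. 30.9] -/
theorem moduleFinite_of_constants (p : ℕ) [Fact p.Prime] [CharP k p]
    (S : Subring (MvPowerSeries (Fin 3) k)) (hS : ∀ x, D x = 0 → x ∈ S) :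
    Module.Finite S (MvPowerSeries (Fin 3) k) := by
  classical
  let k' : Subfield k := ⊤
  haveI : Module.Finite k' k := moduleFinite_top_subfield k
  let b := Module.finBasis k' k
  rw [Module.finite_def, Submodule.fg_def]
  refine ⟨Set.range fun le : Fin (Module.finrank k' k) × (Fin 3 → Fin p) =>
      C (b le.1) * monomial (residueExponent p le.2) (1 : k), Set.finite_range _, ?_⟩
  rw [eq_top_iff]
  rintro φ -
  have hle : pSeriesSubring (n := 3) p k' ≤ S := fun ψ hψ =>
    hS ψ (D_eq_zero_of_mem_pSeriesSubring k D hD p hψ)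
  exact mem_span_of_le hle _ (mem_span_pMonomials p k' b φ)

/-! ### Low-degree vanishing of the coefficients of constants -/

/-- Constants have no monomial `X₀ⁱ` with `p ∤ i`. [folklore] -/
theorem coeff_X0pow_eq_zero (p : ℕ) [Fact p.Prime] [CharP k p] {φ : MvPowerSeries (Fin 3) k}
    (hφ : D φ = 0) {i : ℕ} (hi : 1 ≤ i) (hip : ¬ p ∣ i) :
    coeff (equivFunOnFinite.symm ![i, 0, 0]) φ = 0 := by
  obtain ⟨j, rfl⟩ : ∃ j, i = j + 1 := ⟨i - 1, by omega⟩
  have h := rel k D hD hφ j 0 0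
  simp only [Nat.cast_zero, add_zero, zero_mul, ite_self] at h
  have hj : ((j : k) + 1) ≠ 0 := by
    have : ((j : k) + 1) = ((j + 1 : ℕ) : k) := by push_cast; ring
    rw [this, Ne, CharP.cast_eq_zero_iff k p]
    exact hip
  exact (mul_eq_zero.mp h).resolve_left hj

/-- The even chain: constants have no monomial `X₀^{2i} X₁ᵇ X₂ᶜ` with `p ∤ b + c` and
`2i ≤ 2p - 2` (descending from `a_{2p-2} = 0`, which is the recursion at `j = 2p - 1` where the
factor `2p` vanishes). [folklore] -/
theorem coeff_even_eq_zero (p : ℕ) [Fact p.Prime] [CharP k p] {φ : MvPowerSeries (Fin 3) k}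
    (hφ : D φ = 0) {b c : ℕ} (hbc : ¬ p ∣ b + c) :
    ∀ t : ℕ, t ≤ p - 1 → coeff (equivFunOnFinite.symm ![2 * (p - 1 - t), b, c]) φ = 0 := by
  have hp : p.Prime := Fact.out
  have hp1 : 1 ≤ p := hp.one_lt.le
  have hbc' : ((b : k) + (c : k)) ≠ 0 := by
    rw [← Nat.cast_add, Ne, CharP.cast_eq_zero_iff k p]
    exact hbc
  intro t
  induction t with
  | zero =>
    intro _
    have h := rel k D hD hφ (2 * p - 1) b c
    have hcast : ((2 * p - 1 : ℕ) : k) + 1 = 0 := by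
      have : ((2 * p - 1 : ℕ) : k) + 1 = ((2 * p - 1 + 1 : ℕ) : k) := by push_cast; ring
      rw [this, CharP.cast_eq_zero_iff k p]
      exact ⟨2, by omega⟩
    rw [hcast, zero_mul, zero_add, if_pos (by omega)] at h
    have he : 2 * p - 1 - 1 = 2 * (p - 1 - 0) := by omega
    rw [he] at h
    exact (mul_eq_zero.mp h).resolve_left hbc'
  | succ t ih =>
    intro ht
    have h := rel k D hD hφ (2 * (p - 1 - (t + 1)) + 1) b c
    have he1 : 2 * (p - 1 - (t + 1)) + 1 + 1 = 2 * (p - 1 - t) := by omega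
    have he2 : 2 * (p - 1 - (t + 1)) + 1 - 1 = 2 * (p - 1 - (t + 1)) := by omega
    rw [he1, he2, ih (by omega), mul_zero, zero_add, if_pos (by omega)] at h
    exact (mul_eq_zero.mp h).resolve_left hbc'

/-- **Constants have no monomial `X₁ᵇ X₂ᶜ` with `p ∤ b + c`** (the `X₀`-free part of a constant
is invariant under the Euler field `X₁∂₁ + X₂∂₂`). [folklore] -/
theorem coeff_fs_zero_eq_zero (p : ℕ) [Fact p.Prime] [CharP k p] {φ : MvPowerSeries (Fin 3) k}
    (hφ : D φ = 0) {b c : ℕ} (hbc : ¬ p ∣ b + c) :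
    coeff (equivFunOnFinite.symm ![0, b, c]) φ = 0 := by
  have h := coeff_even_eq_zero k D hD p hφ hbc (p - 1) le_rfl
  rwa [Nat.sub_self, mul_zero] at h

end Summit.ResolutionOfSingularities.ResolutionOfSingularities.Theorems.DescentPerfectToAll.Negative
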